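import Mathlib
import HarnessLib
import Literature.Analysis.ODE.LiouvilleInvariantMeasure
import Literature.MathematicalPhysics.KineticTheory.VelocityFlipEmbeddedChainSteadyState
import Summits.AtomisticToContinuum.FouriersLaw.Theorems.OddSectorIrreversibilityResponseDensityGibbsTranspose
import Summits.AtomisticToContinuum.FouriersLaw.Theorems.VanishingNoiseTransferVanishingNoiseBoundFlipResolventTranspose

/-!
# The transposed resolvent identity for MEASURABLE exponentially bounded data (dual Kubo road: clause (iii), 2/3)

`--supports stmt-AtomisticToContinuum-11976` helper file (crux `VanishingNoiseBound`, route
`VanishingNoiseTransfer`, line `fekete-usc-one-length`, stub S3' `stub_flipForwardFieldRegularity`, wave 4).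
Second step towards clause (iii) of the derivative-free hypothesis `FF''(ε)` (`…FlipDualKuboLink`): the transposed
resolvent identity `∫ (R_r h)(r φ − ᵀLφ) dx = r ∫ φ h dx` of part 1 (`…FlipResolventTranspose`, `h ∈ C_c^∞`) extends to
every MEASURABLE `h` with `|h| ≤ C e^{θH}`, `0 < θ < 1/max(T_L,T_R)` (pinned chain with all parameters `> 0`,
`N ≥ 2`, `T_L, T_R > 0`, `r > 0`, `φ ∈ C_c^∞`). Device: both sides are integrals of `h` against FINITE POSITIVE
measures — `A = (w⁺ dx) R_r + r φ⁻ dx`, `B = (w⁻ dx) R_r + r φ⁺ dx` with `w = rφ − ᵀLφ` — which have the same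
mass (`∫ ᵀLφ dx = ∫ φ · L1 dx = 0`) and agree on `C_c^∞` (part 1), hence are EQUAL
(`measure_ext_of_forall_integral_smooth_eq`, the `C^∞` form of the tree's
`Literature.Analysis.ODE.measure_ext_of_forall_integral_contDiff_eq`); `e^{θH}` is integrable for both by the
Lyapunov bound `R_r e^{θH} ≤ a e^{θH} + b` (`pinnedChain_lintegral_exp_hamiltonian_resolventKernel_le`).

* `measure_ext_of_forall_integral_smooth_eq` — finite measures with equal mass agreeing on `C_c^∞` are equal.
* `pinnedChain_integral_resolvent_mul_transpose` — the transposed resolvent identity for measurable `e^{θH}`-bounded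
  `h`.
* `helper_flipResolventTransposeMeasurable` — registered helper (notation-free restatement).
-/

noncomputable section

open MeasureTheory ProbabilityTheory Filter Topology Set
open scoped ContDiff NNReal ENNReal BoundedContinuousFunction
open Literature.MathematicalPhysics.KineticTheory.HeatConduction
open Literature.MathematicalPhysics.KineticTheory Literature.Probability.Process OscillatorChain

namespace Summit.AtomisticToContinuum.FouriersLaw.Theorems.VanishingNoiseBound

variable {N : ℕ}

/-! ## Finite measures are determined by their mass and by smooth compactly supported test functions -/

/-- **Finite measures on phase space with the same mass that agree on `C_c^∞` are equal** (the `C^∞` twin of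
`Literature.Analysis.ODE.measure_ext_of_forall_integral_contDiff_eq`: the bounded continuous functions `c + ψ`,
`ψ ∈ C_c^∞`, form a point-separating star subalgebra). -/
theorem measure_ext_of_forall_integral_smooth_eq {P P' : Measure (PhaseSpace N)} [IsFiniteMeasure P]
    [IsFiniteMeasure P'] (hmass : P univ = P' univ)
    (h : ∀ ψ : PhaseSpace N → ℝ, ContDiff ℝ ∞ ψ → HasCompactSupport ψ → ∫ x, ψ x ∂P = ∫ x, ψ x ∂P') :
    P = P' := by
  -- adapted from `Literature.Analysis.ODE.measure_ext_of_forall_integral_contDiff_eq` (C¹ ↦ C^∞)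
  let A : StarSubalgebra ℝ (PhaseSpace N →ᵇ ℝ) :=
    { carrier := {g | ∃ (c : ℝ) (ψ : PhaseSpace N → ℝ), ContDiff ℝ ∞ ψ ∧ HasCompactSupport ψ ∧ ∀ x, g x = c + ψ x}
      mul_mem' := by
        rintro g₁ g₂ ⟨c₁, ψ₁, h₁, hc₁, hg₁⟩ ⟨c₂, ψ₂, h₂, hc₂, hg₂⟩
        refine ⟨c₁ * c₂, fun x => c₁ * ψ₂ x + c₂ * ψ₁ x + ψ₁ x * ψ₂ x, ?_, ?_, fun x => ?_⟩
        · exact ((contDiff_const.mul h₂).add (contDiff_const.mul h₁)).add (h₁.mul h₂)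
        · exact ((hc₂.mul_left).add hc₁.mul_left).add hc₁.mul_right
        · rw [BoundedContinuousFunction.coe_mul, Pi.mul_apply, hg₁, hg₂]; ring
      one_mem' := ⟨1, 0, contDiff_const, HasCompactSupport.zero, fun x => by simp⟩
      add_mem' := by
        rintro g₁ g₂ ⟨c₁, ψ₁, h₁, hc₁, hg₁⟩ ⟨c₂, ψ₂, h₂, hc₂, hg₂⟩
        refine ⟨c₁ + c₂, fun x => ψ₁ x + ψ₂ x, h₁.add h₂, hc₁.add hc₂, fun x => ?_⟩
        rw [BoundedContinuousFunction.coe_add, Pi.add_apply, hg₁, hg₂]; ring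
      zero_mem' := ⟨0, 0, contDiff_const, HasCompactSupport.zero, fun x => by simp⟩
      algebraMap_mem' := fun r => ⟨r, 0, contDiff_const, HasCompactSupport.zero, fun x => by simp⟩
      star_mem' := by
        rintro g ⟨c, ψ, h, hc, hg⟩
        exact ⟨c, ψ, h, hc, fun x => by rw [BoundedContinuousFunction.star_apply, star_trivial, hg]⟩ }
  have hA : (A.map (BoundedContinuousFunction.toContinuousMapStarₐ ℝ)).SeparatesPoints := by
    intro x y hxy
    have hs : ({y}ᶜ : Set (PhaseSpace N)) ∈ 𝓝 x := isOpen_compl_singleton.mem_nhds (by simpa using hxy)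
    obtain ⟨ψ, hψs, hψc, hψ1, -, hψx⟩ := exists_contDiff_tsupport_subset (n := ⊤) hs
    have hψcont : Continuous ψ := hψ1.continuous
    obtain ⟨C, hC⟩ := (hψc.isCompact_range hψcont).isBounded.subset_closedBall 0
    let g : PhaseSpace N →ᵇ ℝ := BoundedContinuousFunction.ofNormedAddCommGroup ψ hψcont C fun z => by
      have hz : ψ z ∈ Metric.closedBall (0 : ℝ) C := hC ⟨z, rfl⟩
      rwa [Metric.mem_closedBall, dist_zero_right] at hz
    have hgA : g ∈ A := ⟨0, ψ, hψ1, hψc, fun z => by simp [g]⟩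
    refine ⟨_, ⟨BoundedContinuousFunction.toContinuousMapStarₐ ℝ g, ?_, rfl⟩, ?_⟩
    · rw [SetLike.mem_coe, StarSubalgebra.mem_toSubalgebra, StarSubalgebra.mem_map]
      exact ⟨g, hgA, rfl⟩
    · have hy : ψ y = 0 := by
        have : y ∉ tsupport ψ := fun h' => hψs h' rfl
        exact image_eq_zero_of_notMem_tsupport this
      change g x ≠ g y
      simp [g, hψx, hy]
  refine ext_of_forall_mem_subalgebra_integral_eq_of_polish (𝕜 := ℝ) (A := A) hA fun g hg => ?_
  obtain ⟨c, ψ, hψ, hψc, hgx⟩ := hg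
  have hψi : ∀ (Q : Measure (PhaseSpace N)) [IsFiniteMeasure Q], Integrable ψ Q := fun Q _ =>
    hψ.continuous.integrable_of_hasCompactSupport hψc
  simp_rw [hgx]
  rw [integral_add (integrable_const c) (hψi P), integral_add (integrable_const c) (hψi P'),
    integral_const, integral_const, h ψ hψ hψc, measureReal_def, measureReal_def, hmass]

/-! ## The transposed resolvent identity for measurable exponentially bounded data -/

section Transpose

variable {ω₂ lam β γ : ℝ}

/-- `∫ g d(R ∘ₘ m) = ∫ (∫ g dR(z,·)) m(dz)` for a finite measure `m`, a Markov kernel `R` and an `R ∘ₘ m`-integrable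
`g`. -/
theorem integral_comp_of_integrable (R : Kernel (PhaseSpace N) (PhaseSpace N)) [IsMarkovKernel R]
    (m : Measure (PhaseSpace N)) [IsFiniteMeasure m] {g : PhaseSpace N → ℝ}
    (hg : Integrable g (R ∘ₘ m)) : ∫ y, g y ∂(R ∘ₘ m) = ∫ z, ∫ y, g y ∂(R z) ∂m := by
  rw [Measure.comp_eq_comp_const_apply] at hg ⊢
  rw [Kernel.integral_comp hg, Kernel.const_apply]

/-- **The transposed resolvent identity for measurable `e^{θH}`-bounded data.** For the pinned chain (all parameters
`> 0`), `N ≥ 2`, `T_L, T_R > 0`, `r > 0`, `0 < θ < 1/max(T_L,T_R)`, `φ ∈ C_c^∞` and a measurable `h` with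
`|h| ≤ C e^{θH}`: `∫ (R_r h)(r φ − ᵀLφ) dx = r ∫ φ h dx` (`ᵀLφ = L̂φ + 2γφ`). -/
theorem pinnedChain_integral_resolvent_mul_transpose (hω : 0 < ω₂) (hl : 0 < lam) (hβ : 0 < β) (hγ : 0 < γ)
    (hN : 1 < N) {T_L T_R : ℝ} (hTL : 0 < T_L) (hTR : 0 < T_R) {r : ℝ} (hr : 0 < r) {θ : ℝ} (hθ : 0 < θ)
    (hθ' : θ < 1 / max T_L T_R) {φ : PhaseSpace N → ℝ} (hφ : ContDiff ℝ ∞ φ) (hφc : HasCompactSupport φ)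
    {h : PhaseSpace N → ℝ} (hhm : Measurable h) {C : ℝ}
    (hhb : ∀ y, |h y| ≤ C * Real.exp (θ * (pinnedChain ω₂ lam β γ).hamiltonian N y)) :
    ∫ x, (∫ y, h y ∂((pinnedChainSemigroup hω hl.le hβ.le hγ.le (Nat.zero_lt_of_lt hN) hTL.le
        hTR.le).resolventKernel r x)) *
        (r * φ x - (sdeGenerator (fun y => -(pinnedChain ω₂ lam β γ).drift N y)
            ((pinnedChain ω₂ lam β γ).bathVecL N T_L) ((pinnedChain ω₂ lam β γ).bathVecR N T_R) φ x +
          2 * γ * φ x)) =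
      r * ∫ x, φ x * h x := by
  have hN0 : 0 < N := Nat.zero_lt_of_lt hN
  set P := pinnedChain ω₂ lam β γ with hPdef
  set Sg := pinnedChainSemigroup hω hl.le hβ.le hγ.le hN0 hTL.le hTR.le with hSg
  set R := Sg.resolventKernel r with hRdef
  haveI hRM : IsMarkovKernel R := Sg.isMarkovKernel_resolventKernel hr
  set H : PhaseSpace N → ℝ := P.hamiltonian N with hH
  have hHc : Continuous H := pinnedChain_continuous_hamiltonian ω₂ lam β γ N
  have hU : ContDiff ℝ ∞ P.U := pinnedChain_contDiff_U ω₂ lam β γ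
  have hV : ContDiff ℝ ∞ P.V := pinnedChain_contDiff_V ω₂ lam β γ
  set Lh : PhaseSpace N → ℝ := fun x => sdeGenerator (fun y => -P.drift N y) (P.bathVecL N T_L)
    (P.bathVecR N T_R) φ x + 2 * γ * φ x with hLh
  set w : PhaseSpace N → ℝ := fun x => r * φ x - Lh x with hw
  have hLhc : Continuous Lh :=
    (continuous_sdeGenerator _ _ (P.contDiff_drift hU hV N).continuous.neg (hφ.of_le (by norm_cast))).add
      (continuous_const.mul hφ.continuous)
  have hLhs : HasCompactSupport Lh := (hasCompactSupport_sdeGenerator _ _ hφc).add hφc.mul_left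
  have hφc' : Continuous φ := hφ.continuous
  have hwc : Continuous w := (continuous_const.mul hφc').sub hLhc
  have hws : HasCompactSupport w := (hφc.mul_left).sub hLhs
  -- positive and negative parts
  set wp : PhaseSpace N → ℝ := fun x => max (w x) 0 with hwp
  set wm : PhaseSpace N → ℝ := fun x => max (-w x) 0 with hwm
  set fp : PhaseSpace N → ℝ := fun x => r * max (φ x) 0 with hfp
  set fm : PhaseSpace N → ℝ := fun x => r * max (-φ x) 0 with hfm
  have hwpc : Continuous wp := by rw [hwp]; fun_prop
  have hwmc : Continuous wm := by rw [hwm]; fun_prop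
  have hfpc : Continuous fp := by rw [hfp]; fun_prop
  have hfmc : Continuous fm := by rw [hfm]; fun_prop
  have hwp0 : ∀ x, 0 ≤ wp x := fun x => le_max_right _ _
  have hwm0 : ∀ x, 0 ≤ wm x := fun x => le_max_right _ _
  have hfp0 : ∀ x, 0 ≤ fp x := fun x => by rw [hfp]; positivity
  have hfm0 : ∀ x, 0 ≤ fm x := fun x => by rw [hfm]; positivity
  have hsupp : ∀ {a b : PhaseSpace N → ℝ}, HasCompactSupport a → (∀ x, a x = 0 → b x = 0) → HasCompactSupport b :=
    fun ha hab => ha.mono fun x hx => by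
      contrapose! hx
      simp only [Function.mem_support, ne_eq, not_not] at hx ⊢
      exact hab x hx
  have hwps : HasCompactSupport wp := hsupp hws fun x hx => by simp [hwp, hx]
  have hwms : HasCompactSupport wm := hsupp hws fun x hx => by simp [hwm, hx]
  have hfps : HasCompactSupport fp := hsupp hφc fun x hx => by simp [hfp, hx]
  have hfms : HasCompactSupport fm := hsupp hφc fun x hx => by simp [hfm, hx]
  have hwpm : w = fun x => wp x - wm x := by funext x; simp only [hwp, hwm]; rw [max_zero_sub_max_neg_zero_eq_self]
  have hfpm : ∀ x, fp x - fm x = r * φ x := fun x => by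
    simp only [hfp, hfm]; rw [← mul_sub, max_zero_sub_max_neg_zero_eq_self]
  -- the four finite measures
  have hdens : ∀ {a : PhaseSpace N → ℝ}, Continuous a → HasCompactSupport a →
      IsFiniteMeasure ((volume : Measure (PhaseSpace N)).withDensity fun x => ENNReal.ofReal (a x)) := by
    intro a ha has
    refine isFiniteMeasure_withDensity ?_
    have hi : Integrable a := ha.integrable_of_hasCompactSupport has
    exact (lintegral_ofReal_le_lintegral_enorm a).trans_lt hi.2 |>.ne
  set mwp : Measure (PhaseSpace N) := volume.withDensity fun x => ENNReal.ofReal (wp x) with hmwp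
  set mwm : Measure (PhaseSpace N) := volume.withDensity fun x => ENNReal.ofReal (wm x) with hmwm
  set mfp : Measure (PhaseSpace N) := volume.withDensity fun x => ENNReal.ofReal (fp x) with hmfp
  set mfm : Measure (PhaseSpace N) := volume.withDensity fun x => ENNReal.ofReal (fm x) with hmfm
  haveI : IsFiniteMeasure mwp := hdens hwpc hwps
  haveI : IsFiniteMeasure mwm := hdens hwmc hwms
  haveI : IsFiniteMeasure mfp := hdens hfpc hfps
  haveI : IsFiniteMeasure mfm := hdens hfmc hfms
  set A : Measure (PhaseSpace N) := (R ∘ₘ mwp) + mfm with hA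
  set B : Measure (PhaseSpace N) := (R ∘ₘ mwm) + mfp with hB
  -- integration against the four measures
  have hwith : ∀ {a : PhaseSpace N → ℝ}, Continuous a → (∀ x, 0 ≤ a x) → ∀ g : PhaseSpace N → ℝ,
      ∫ x, g x ∂(volume.withDensity fun x => ENNReal.ofReal (a x)) = ∫ x, a x * g x := by
    intro a ha ha0 g
    rw [integral_withDensity_eq_integral_toReal_smul (by fun_prop) (Eventually.of_forall fun _ => ENNReal.ofReal_lt_top)]
    refine integral_congr_ae (ae_of_all _ fun x => ?_)
    simp only [ENNReal.toReal_ofReal (ha0 x), smul_eq_mul]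
  have hwith_int : ∀ {a : PhaseSpace N → ℝ}, Continuous a → (∀ x, 0 ≤ a x) → ∀ {g : PhaseSpace N → ℝ},
      Integrable (fun x => a x * g x) → Integrable g (volume.withDensity fun x => ENNReal.ofReal (a x)) := by
    intro a ha ha0 g hg
    rw [integrable_withDensity_iff_integrable_smul' (by fun_prop) (Eventually.of_forall fun _ => ENNReal.ofReal_lt_top)]
    refine hg.congr (ae_of_all _ fun x => ?_)
    simp only [ENNReal.toReal_ofReal (ha0 x), smul_eq_mul]
  -- the Lyapunov weight and the affine bounds
  obtain ⟨a, b, ha, hb, hlyap⟩ :=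
    pinnedChain_lintegral_exp_hamiltonian_resolventKernel_le hω hl hβ hγ hN hTL hTR hr hθ hθ'
  let V : PhaseSpace N → ℝ≥0 := fun y => (Real.exp (θ * H y)).toNNReal
  have hVc : Continuous V := continuous_real_toNNReal.comp (Real.continuous_exp.comp (continuous_const.mul hHc))
  have hVm : Measurable V := hVc.measurable
  have hVcoe : ∀ y, ((V y : ℝ≥0) : ℝ≥0∞) = ENNReal.ofReal (Real.exp (θ * H y)) := fun y => rfl
  have hVreal : ∀ y, ((V y : ℝ≥0) : ℝ) = Real.exp (θ * H y) := fun y => Real.coe_toNNReal _ (Real.exp_pos _).le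
  have ha' : a ≠ ⊤ := (ha.trans_le le_top).ne
  have hRV : ∀ z, ∫⁻ y, (V y : ℝ≥0∞) ∂(R z) ≤ a * V z + b := fun z => hlyap z
  have hRVtop : ∀ z, ∫⁻ y, (V y : ℝ≥0∞) ∂(R z) ≠ ⊤ := fun z =>
    ne_top_of_le_ne_top (by simp [ENNReal.mul_eq_top, ha', hb]) (hRV z)
  have hC0 : 0 ≤ C := by
    have h1 := hhb 0
    exact nonneg_of_mul_nonneg_left ((abs_nonneg _).trans h1) (Real.exp_pos _)
  have hhV : ∀ y, |h y| ≤ 0 + C * (V y : ℝ) := fun y => by rw [zero_add, hVreal]; exact hhb y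
  -- `R h`: measurable with the affine bound `|R h| ≤ C (a V + b)`
  set Rh : PhaseSpace N → ℝ := fun x => ∫ y, h y ∂(R x) with hRh
  have hRhm : Measurable Rh := (hhm.stronglyMeasurable.integral_kernel (κ := R)).measurable
  have hRhb : ∀ x, |Rh x| ≤ C * (a.toReal * Real.exp (θ * H x) + b.toReal) := by
    intro x
    have h1 := Harris.abs_integral_le_of_abs_le_affine hVm (hRVtop x) hhm hhV
    rw [zero_mul, zero_add] at h1
    refine h1.trans (mul_le_mul_of_nonneg_left ?_ hC0)
    have h2 : (∫⁻ y, (V y : ℝ≥0∞) ∂(R x)).toReal ≤ (a * V x + b).toReal :=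
      ENNReal.toReal_mono (by simp [ENNReal.mul_eq_top, ha', hb]) (hRV x)
    rw [ENNReal.toReal_add (by simp [ENNReal.mul_eq_top, ha']) hb, ENNReal.toReal_mul] at h2
    simpa [hVreal] using h2
  -- products of compactly supported continuous functions with locally bounded measurable ones are integrable
  have hprod : ∀ {u v : PhaseSpace N → ℝ} {Bd : PhaseSpace N → ℝ}, Continuous u → HasCompactSupport u →
      Measurable v → Continuous Bd → (∀ x, |v x| ≤ Bd x) → Integrable (fun x => u x * v x) := by
    intro u v Bd hu hus hv hBd hvb
    have hdom : Integrable (fun x => ‖u x‖ * Bd x) :=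
      (hu.norm.mul hBd).integrable_of_hasCompactSupport hus.norm.mul_right
    refine hdom.mono' (hu.aestronglyMeasurable.mul hv.aestronglyMeasurable) (ae_of_all _ fun x => ?_)
    rw [norm_mul, Real.norm_eq_abs, Real.norm_eq_abs (v x)]
    exact mul_le_mul_of_nonneg_left (hvb x) (abs_nonneg _)
  have hBdc : Continuous fun x => C * (a.toReal * Real.exp (θ * H x) + b.toReal) := by fun_prop
  have hEc : Continuous fun x => C * Real.exp (θ * H x) := by fun_prop
  -- integrability of `h` against `R ∘ₘ (u dx)` for `u ∈ C_c`, `u ≥ 0`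
  have hintR : ∀ {u : PhaseSpace N → ℝ} (hu : Continuous u) (hus : HasCompactSupport u), (∀ x, 0 ≤ u x) →
      Integrable h (R ∘ₘ (volume.withDensity fun x => ENNReal.ofReal (u x))) := by
    intro u hu hus hu0
    set m : Measure (PhaseSpace N) := volume.withDensity fun x => ENNReal.ofReal (u x) with hm
    haveI : IsFiniteMeasure m := hdens hu hus
    obtain ⟨K, hK⟩ : ∃ K, ∀ x, u x * (a.toReal * Real.exp (θ * H x) + b.toReal) ≤ K := by
      have hc : Continuous fun x => u x * (a.toReal * Real.exp (θ * H x) + b.toReal) := by fun_prop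
      obtain ⟨K, hK⟩ := hc.bounded_above_of_compact_support hus.mul_right
      exact ⟨K, fun x => (le_abs_self _).trans (Real.norm_eq_abs _ ▸ hK x)⟩
    have hexp : ∫⁻ y, (V y : ℝ≥0∞) ∂(R ∘ₘ m) < ⊤ := by
      have hmV : Measurable fun y => ((V y : ℝ≥0) : ℝ≥0∞) := measurable_coe_nnreal_ennreal.comp hVm
      change ∫⁻ y, (V y : ℝ≥0∞) ∂(m.bind R) < ⊤
      rw [Measure.lintegral_bind R.measurable.aemeasurable hmV.aemeasurable]
      calc ∫⁻ z, ∫⁻ y, (V y : ℝ≥0∞) ∂(R z) ∂m ≤ ∫⁻ z, (a * V z + b) ∂m := lintegral_mono fun z => hRV z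
        _ = ∫⁻ z, ENNReal.ofReal (u z) * (a * V z + b) ∂volume := by
            rw [hm, lintegral_withDensity_eq_lintegral_mul₀ (μ := volume) (f := fun x => ENNReal.ofReal (u x))
              (by fun_prop) (g := fun z => a * (V z : ℝ≥0∞) + b)
              ((measurable_const.mul hmV).add measurable_const).aemeasurable]
            rfl
        _ ≤ ∫⁻ z, (tsupport u).indicator (fun _ => ENNReal.ofReal K) z ∂volume := by
            refine lintegral_mono fun z => ?_
            by_cases hz : z ∈ tsupport u
            · rw [indicator_of_mem hz, hVcoe, ← ENNReal.ofReal_toReal ha', ← ENNReal.ofReal_toReal hb,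
                ← ENNReal.ofReal_mul ENNReal.toReal_nonneg, ← ENNReal.ofReal_add (by positivity) ENNReal.toReal_nonneg,
                ← ENNReal.ofReal_mul (hu0 z)]
              exact ENNReal.ofReal_le_ofReal (hK z)
            · rw [indicator_of_notMem hz, image_eq_zero_of_notMem_tsupport hz, ENNReal.ofReal_zero, zero_mul]
        _ < ⊤ := by
            rw [lintegral_indicator_const (isClosed_tsupport u).measurableSet]
            exact ENNReal.mul_lt_top ENNReal.ofReal_lt_top hus.isCompact.measure_lt_top
    exact Harris.integrable_of_abs_le_affine hVm hexp.ne hhm hhV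
  have hhA1 : Integrable h (R ∘ₘ mwp) := hintR hwpc hwps hwp0
  have hhB1 : Integrable h (R ∘ₘ mwm) := hintR hwmc hwms hwm0
  have hhA2 : Integrable h mfm := hwith_int hfmc hfm0 (hprod hfmc hfms hhm hEc hhb)
  have hhB2 : Integrable h mfp := hwith_int hfpc hfp0 (hprod hfpc hfps hhm hEc hhb)
  -- (1) equal mass: `∫ w dx = r ∫ φ dx` since `∫ ᵀLφ dx = ∫ φ · L1 dx = 0`
  have hγ' : P.γ = γ := rfl
  have hLh0 : ∫ x, Lh x = 0 := by
    have h1 := langevin_integral_revGenerator_mul P hU hV hN0 (T_L := T_L) (T_R := T_R)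
      (by rw [hγ']; positivity) (by rw [hγ']; positivity) hφ hφc (contDiff_const (c := (1 : ℝ)))
    simp only [OscillatorChain.generator_const, mul_zero, integral_zero, mul_one, hγ'] at h1
    rw [hLh]
    exact h1
  have hφi : Integrable φ := hφc'.integrable_of_hasCompactSupport hφc
  have hLhi : Integrable Lh := hLhc.integrable_of_hasCompactSupport hLhs
  have hwpi : Integrable wp := hwpc.integrable_of_hasCompactSupport hwps
  have hwmi : Integrable wm := hwmc.integrable_of_hasCompactSupport hwms
  have hfpi : Integrable fp := hfpc.integrable_of_hasCompactSupport hfps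
  have hfmi : Integrable fm := hfmc.integrable_of_hasCompactSupport hfms
  have hw_int : ∫ x, w x = r * ∫ x, φ x := by
    rw [hw]
    show ∫ x, (r * φ x - Lh x) = _
    rw [integral_sub (hφi.const_mul r) hLhi, integral_const_mul, hLh0, sub_zero]
  have hcomp_univ : ∀ (m : Measure (PhaseSpace N)) [IsFiniteMeasure m], (R ∘ₘ m) univ = m univ := by
    intro m _
    rw [Measure.bind_apply MeasurableSet.univ R.measurable.aemeasurable]
    simp
  have hwd : ∀ {u : PhaseSpace N → ℝ}, Continuous u → (∀ x, 0 ≤ u x) → HasCompactSupport u →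
      (volume.withDensity fun x => ENNReal.ofReal (u x)) univ = ENNReal.ofReal (∫ x, u x) := by
    intro u hu hu0 hus
    rw [withDensity_apply _ MeasurableSet.univ, Measure.restrict_univ,
      ← ofReal_integral_eq_lintegral_ofReal (hu.integrable_of_hasCompactSupport hus) (ae_of_all _ hu0)]
  have hmass : A univ = B univ := by
    rw [hA, hB, Measure.add_apply, Measure.add_apply, hcomp_univ, hcomp_univ, hmwp, hmwm, hmfp, hmfm,
      hwd hwpc hwp0 hwps, hwd hfmc hfm0 hfms, hwd hwmc hwm0 hwms, hwd hfpc hfp0 hfps,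
      ← ENNReal.ofReal_add (integral_nonneg hwp0) (integral_nonneg hfm0),
      ← ENNReal.ofReal_add (integral_nonneg hwm0) (integral_nonneg hfp0)]
    congr 1
    have e1 : (∫ x, wp x) - ∫ x, wm x = ∫ x, w x := by
      rw [← integral_sub hwpi hwmi, hwpm]
    have e2 : (∫ x, fp x) - ∫ x, fm x = r * ∫ x, φ x := by
      rw [← integral_sub hfpi hfmi, ← integral_const_mul]
      exact integral_congr_ae (ae_of_all _ hfpm)
    linarith
  -- (2) the two measures agree on `C_c^∞` (part 1)
  haveI : IsFiniteMeasure A := by rw [hA]; infer_instance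
  haveI : IsFiniteMeasure B := by rw [hB]; infer_instance
  have hagree : ∀ ψ : PhaseSpace N → ℝ, ContDiff ℝ ∞ ψ → HasCompactSupport ψ →
      ∫ x, ψ x ∂A = ∫ x, ψ x ∂B := by
    intro ψ hψ hψc
    have hψcont : Continuous ψ := hψ.continuous
    have hψi : ∀ (Q : Measure (PhaseSpace N)) [IsFiniteMeasure Q], Integrable ψ Q := fun Q _ =>
      hψcont.integrable_of_hasCompactSupport hψc
    obtain ⟨Cψ, hCψ⟩ : ∃ C, ∀ x, ‖ψ x‖ ≤ C := hψcont.bounded_above_of_compact_support hψc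
    set Rψ : PhaseSpace N → ℝ := fun x => ∫ y, ψ y ∂(R x) with hRψ
    have hRψm : Measurable Rψ := (hψcont.stronglyMeasurable.integral_kernel (κ := R)).measurable
    have hRψb : ∀ x, |Rψ x| ≤ Cψ := fun x => by
      rw [← Real.norm_eq_abs]
      exact (norm_integral_le_of_norm_le_const (Eventually.of_forall hCψ)).trans (by simp)
    have hD1 : ∫ x, Rψ x * w x = r * ∫ x, φ x * ψ x :=
      pinnedChain_integral_resolvent_mul_transpose_smooth hω hl.le hβ.le hγ.le hN0 hTL.le hTR.le hr hφ hφc hψ hψc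
    rw [hA, hB, integral_add_measure (hψi _) (hψi _), integral_add_measure (hψi _) (hψi _),
      integral_comp_of_integrable R mwp (hψi _), integral_comp_of_integrable R mwm (hψi _),
      hmwp, hmwm, hmfp, hmfm, hwith hwpc hwp0, hwith hwmc hwm0, hwith hfmc hfm0, hwith hfpc hfp0]
    have i1 := hprod hwpc hwps hRψm continuous_const hRψb
    have i2 := hprod hwmc hwms hRψm continuous_const hRψb
    have i3 := hprod hfpc hfps hψcont.measurable (continuous_const (y := Cψ)) fun x =>
      (Real.norm_eq_abs _).symm.le.trans (hCψ x)
    have i4 := hprod hfmc hfms hψcont.measurable (continuous_const (y := Cψ)) fun x =>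
      (Real.norm_eq_abs _).symm.le.trans (hCψ x)
    have e1 : (∫ x, wp x * Rψ x) - ∫ x, wm x * Rψ x = ∫ x, Rψ x * w x := by
      rw [← integral_sub i1 i2]
      refine integral_congr_ae (ae_of_all _ fun x => ?_)
      rw [hwpm]; ring
    have e2 : (∫ x, fp x * ψ x) - ∫ x, fm x * ψ x = r * ∫ x, φ x * ψ x := by
      rw [← integral_sub i3 i4, ← integral_const_mul]
      refine integral_congr_ae (ae_of_all _ fun x => ?_)
      show fp x * ψ x - fm x * ψ x = r * (φ x * ψ x)
      rw [← sub_mul, hfpm x]; ring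
    change (∫ x, wp x * Rψ x) + ∫ x, fm x * ψ x = (∫ x, wm x * Rψ x) + ∫ x, fp x * ψ x
    linarith
  -- (3) hence `A = B`, and the identity for `h`
  have hAB : A = B := measure_ext_of_forall_integral_smooth_eq hmass hagree
  have hfin : ∫ x, h x ∂A = ∫ x, h x ∂B := by rw [hAB]
  rw [hA, hB, integral_add_measure hhA1 hhA2, integral_add_measure hhB1 hhB2,
    integral_comp_of_integrable R mwp hhA1, integral_comp_of_integrable R mwm hhB1,
    hmwp, hmwm, hmfp, hmfm, hwith hwpc hwp0, hwith hwmc hwm0, hwith hfmc hfm0, hwith hfpc hfp0] at hfin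
  have i1 := hprod hwpc hwps hRhm hBdc hRhb
  have i2 := hprod hwmc hwms hRhm hBdc hRhb
  have i3 := hprod hfpc hfps hhm hEc hhb
  have i4 := hprod hfmc hfms hhm hEc hhb
  have e1 : (∫ x, wp x * Rh x) - ∫ x, wm x * Rh x = ∫ x, Rh x * w x := by
    rw [← integral_sub i1 i2]
    refine integral_congr_ae (ae_of_all _ fun x => ?_)
    rw [hwpm]; ring
  have e2 : (∫ x, fp x * h x) - ∫ x, fm x * h x = r * ∫ x, φ x * h x := by
    rw [← integral_sub i3 i4, ← integral_const_mul]
    refine integral_congr_ae (ae_of_all _ fun x => ?_)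
    show fp x * h x - fm x * h x = r * (φ x * h x)
    rw [← sub_mul, hfpm x]; ring
  change (∫ x, wp x * Rh x) + ∫ x, fm x * h x = (∫ x, wm x * Rh x) + ∫ x, fp x * h x at hfin
  change ∫ x, Rh x * w x = r * ∫ x, φ x * h x
  linarith

end Transpose

/-! ## Registered helper -/

/-- Registered helper sub-goal `helper_flipResolventTransposeMeasurable` of stub `stub_flipForwardFieldRegularity` (line
`fekete-usc-one-length`, crux stmt-AtomisticToContinuum-11976): the transposed resolvent identity for measurable
`e^{θH}`-bounded data (`pinnedChain_integral_resolvent_mul_transpose`). -/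
theorem helper_flipResolventTransposeMeasurable : ∀ (ω₂ lam β γ : ℝ) (hω : 0 < ω₂) (hl : 0 < lam) (hβ : 0 < β) (hγ : 0 < γ) (N : ℕ) (hN : 1 < N) (T_L T_R : ℝ) (hTL : 0 < T_L) (hTR : 0 < T_R) (r : ℝ), 0 < r → ∀ (θ : ℝ), 0 < θ → θ < 1 / max T_L T_R → ∀ (φ : Literature.MathematicalPhysics.KineticTheory.HeatConduction.PhaseSpace N → ℝ), ContDiff ℝ ((⊤ : ℕ∞) : WithTop ℕ∞) φ → HasCompactSupport φ → ∀ (h : Literature.MathematicalPhysics.KineticTheory.HeatConduction.PhaseSpace N → ℝ), Measurable h → ∀ (C : ℝ), (∀ y, |h y| ≤ C * Real.exp (θ * (Literature.MathematicalPhysics.KineticTheory.HeatConduction.pinnedChain ω₂ lam β γ).hamiltonian N y)) → MeasureTheory.integral MeasureTheory.volume (fun x => MeasureTheory.integral ((Literature.MathematicalPhysics.KineticTheory.HeatConduction.pinnedChainSemigroup hω (le_of_lt hl) (le_of_lt hβ) (le_of_lt hγ) (Nat.zero_lt_of_lt hN) (le_of_lt hTL) (le_of_lt hTR)).resolventKernel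 r x) (fun y => h y) * (r * φ x - (Literature.MathematicalPhysics.KineticTheory.sdeGenerator (fun y => -((Literature.MathematicalPhysics.KineticTheory.HeatConduction.pinnedChain ω₂ lam β γ).drift N y)) ((Literature.MathematicalPhysics.KineticTheory.HeatConduction.pinnedChain ω₂ lam β γ).bathVecL N T_L) ((Literature.MathematicalPhysics.KineticTheory.HeatConduction.pinnedChain ω₂ lam β γ).bathVecR N T_R) φ x + 2 * γ * φ x))) = r * MeasureTheory.integral MeasureTheory.volume (fun x => φ x * h x) :=
  fun _ _ _ _ hω hl hβ hγ _ hN _ _ hTL hTR _ hr _ hθ hθ' _ hφ hφc _ hhm _ hhb =>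
    pinnedChain_integral_resolvent_mul_transpose hω hl hβ hγ hN hTL hTR hr hθ hθ' hφ hφc hhm hhb

end Summit.AtomisticToContinuum.FouriersLaw.Theorems.VanishingNoiseBound

end
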